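import Mathlib
import Literature.Analysis.PDE.NearInverseSquareFarKernelData
import Literature.Analysis.ODE.InverseSquareLadderMonomials
import Literature.Analysis.Calculus.TaylorJet

/-!
# The exact far kernel data (ladders of Taylor sums) are admissible energy data

Analysis/PDE support file (everything proved). For the smooth `ι = 1/x` on `[½,∞)` and a continuous
`W ≥ 0` with `W ≤ (n(n+1)+1) ι²` on `[1,∞)` (any near-inverse-square potential), the Darboux ladder
`P = ladder ι n (Taylor sum of degree ≤ n)` is `C¹`, `Q = ladder ι n (Taylor sum of degree < n)` is
continuous, and the three pieces `(P')², W P², Q²` of the `W`-energy density of the datum `(P, Q)`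
are integrable on `(1,∞)` (`ladderTaylor_admissible`): on `(½,∞)` both are finite combinations of
powers `ι^{n−2k}` (`InverseSquareLadderMonomials`). These data span the exact kernel `D₀` of the far
channel estimate at unit scale; used by the kernel-absorption step of `FixedModeChannels`
(route PhotonSphereChannels, stmt-FinalStateConjecture-10048). Folklore.
-/

noncomputable section

namespace Literature.Analysis.PDE

open Set Filter MeasureTheory Finset Literature.Analysis.ODE Literature.Analysis.Calculus
open scoped _root_.Topology

variable {ι : ℝ → ℝ}

/-! ### The exact kernel data are admissible -/

/-- The ladder of a Taylor sum of degree `≤ n`: `C^∞`, and on `(1,∞)` the `W`-energy pieces are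
integrable (`W ≤ (n(n+1)+1) ι²` there). [folklore] -/
theorem ladderTaylor_admissible (hι : ContDiff ℝ (⊤ : ℕ∞) ι)
    (hιeq : ∀ x : ℝ, 1 / 2 ≤ x → ι x = x⁻¹) (n : ℕ) {W : ℝ → ℝ} (hW : Continuous W)
    (hW0 : ∀ x, 0 ≤ W x) (hWle : ∀ x, 1 ≤ x → W x ≤ ((n : ℝ) * (n + 1) + 1) * ι x ^ 2)
    (ch cg : ℕ → ℝ) :
    ContDiff ℝ 1 (ladder ι n (fun z => ∑ m ∈ Finset.range (n + 1), ch m / m.factorial * (z - 1) ^ m)) ∧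
    Continuous (ladder ι n (fun z => ∑ m ∈ Finset.range n, cg m / m.factorial * (z - 1) ^ m)) ∧
    IntegrableOn (fun x => deriv (ladder ι n (fun z => ∑ m ∈ Finset.range (n + 1),
      ch m / m.factorial * (z - 1) ^ m)) x ^ 2) (Ioi 1) ∧
    IntegrableOn (fun x => W x * (ladder ι n (fun z => ∑ m ∈ Finset.range (n + 1),
      ch m / m.factorial * (z - 1) ^ m)) x ^ 2) (Ioi 1) ∧
    IntegrableOn (fun x => (ladder ι n (fun z => ∑ m ∈ Finset.range n,
      cg m / m.factorial * (z - 1) ^ m)) x ^ 2) (Ioi 1) := by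
  set P : ℝ → ℝ := ladder ι n (fun z => ∑ m ∈ Finset.range (n + 1),
    ch m / m.factorial * (z - 1) ^ m) with hP
  set Q : ℝ → ℝ := ladder ι n (fun z => ∑ m ∈ Finset.range n, cg m / m.factorial * (z - 1) ^ m)
    with hQ
  have hPC : ContDiff ℝ 1 P := contDiff_ladder hι (m := 1)
    ((contDiff_taylorSum ch n 1).of_le (by exact_mod_cast le_top))
  have hQC : ContDiff ℝ 0 Q := by
    refine contDiff_ladder hι (m := 0) ?_
    cases n with
    | zero => simp only [Finset.range_zero, Finset.sum_empty]; exact contDiff_const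
    | succ k => exact (contDiff_taylorSum cg k 1).of_le (by exact_mod_cast le_top)
  have hQc : Continuous Q := hQC.continuous
  -- power representations on `(1/2, ∞)`
  obtain ⟨α, hα⟩ := exists_ladder_taylorSum_eq hι hιeq n (fun m => ch m / m.factorial) 1
  obtain ⟨β, hβ⟩ := exists_ladder_taylorSum_lt_eq hι hιeq n (fun m => cg m / m.factorial) 1
  have hPeq : ∀ x, 1 / 2 < x → P x = ∑ k ∈ Finset.range (n / 2 + 1), α k * ι x ^ (n - 2 * k) :=
    fun x hx => hα x hx
  have hQeq : ∀ x, 1 / 2 < x → Q x = ∑ k ∈ Finset.range ((n + 1) / 2), β k * ι x ^ (n - 2 * k) :=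
    fun x hx => hβ x hx
  have hPev : ∀ x, 1 / 2 < x → P =ᶠ[𝓝 x] fun y => ∑ k ∈ Finset.range (n / 2 + 1), α k * ι y ^ (n - 2 * k) :=
    fun x hx => Filter.mem_of_superset (Ioi_mem_nhds hx) fun y hy => hPeq y hy
  have hdP : ∀ x, 1 < x → deriv P x
      = ∑ k ∈ Finset.range (n / 2 + 1), α k * (-((n - 2 * k : ℕ) : ℝ) * ι x ^ (n - 2 * k + 1)) := by
    intro x hx
    have hx' : (1 / 2 : ℝ) < x := by linarith
    rw [(hPev x hx').deriv_eq]
    rw [deriv_fun_sum fun k _ => ((hι.pow _).differentiable (by simp) x).const_mul _]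
    refine Finset.sum_congr rfl fun k _ => ?_
    rw [deriv_const_mul _ ((hι.pow _).differentiable (by simp) x), deriv_iota_pow hιeq _ hx']
  -- domination by finite sums of `ι`-powers (Cauchy–Schwarz in the finite sum)
  have cs : ∀ (s : Finset ℕ) (f : ℕ → ℝ), (∑ k ∈ s, f k) ^ 2 ≤ s.card * ∑ k ∈ s, f k ^ 2 :=
    fun s f => sq_sum_le_card_mul_sum_sq
  refine ⟨hPC, hQc, ?_, ?_, ?_⟩
  · -- `(P')²`
    set m := n / 2 + 1
    have hdom : IntegrableOn (fun x => (m : ℝ) * ∑ k ∈ Finset.range m,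
        (α k * ((n - 2 * k : ℕ) : ℝ)) ^ 2 * ι x ^ (2 * (n - 2 * k + 1))) (Ioi 1) := by
      refine Integrable.const_mul (integrable_finsetSum _ fun k _ => ?_) _
      have := integrableOn_mul_iota_pow hι hιeq (f := fun _ => (α k * ((n - 2 * k : ℕ) : ℝ)) ^ 2)
        continuous_const (C := (α k * ((n - 2 * k : ℕ) : ℝ)) ^ 2)
        (fun x _ => le_of_eq (abs_of_nonneg (sq_nonneg _))) (p := 2 * (n - 2 * k + 1)) (by omega)
      exact this
    refine Integrable.mono' hdom ((hPC.continuous_deriv le_rfl).pow 2).aestronglyMeasurable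
      ((ae_restrict_iff' measurableSet_Ioi).2 (ae_of_all _ fun x hx => ?_))
    rw [Real.norm_eq_abs, abs_of_nonneg (sq_nonneg _), hdP x hx]
    refine (cs _ _).trans ?_
    rw [Finset.card_range]
    refine mul_le_mul_of_nonneg_left (le_of_eq (Finset.sum_congr rfl fun k _ => ?_)) (by positivity)
    rw [pow_mul']; ring
  · -- `W P²`
    set m := n / 2 + 1
    have hdom : IntegrableOn (fun x => (((n : ℝ) * (n + 1) + 1) * m) * ∑ k ∈ Finset.range m,
        (α k) ^ 2 * ι x ^ (2 * (n - 2 * k + 1))) (Ioi 1) := by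
      refine Integrable.const_mul (integrable_finsetSum _ fun k _ => ?_) _
      exact integrableOn_mul_iota_pow hι hιeq (f := fun _ => (α k) ^ 2) continuous_const (C := (α k) ^ 2)
        (fun x _ => le_of_eq (abs_of_nonneg (sq_nonneg _))) (p := 2 * (n - 2 * k + 1)) (by omega)
    refine Integrable.mono' hdom ((hW.mul (hPC.continuous.pow 2))).aestronglyMeasurable
      ((ae_restrict_iff' measurableSet_Ioi).2 (ae_of_all _ fun x hx => ?_))
    have hx1 : (1 : ℝ) ≤ x := le_of_lt hx
    rw [Real.norm_eq_abs, abs_of_nonneg (mul_nonneg (hW0 x) (sq_nonneg _)), hPeq x (by linarith)]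
    have hιP : ι x ^ 2 * (∑ k ∈ Finset.range m, α k * ι x ^ (n - 2 * k)) ^ 2
        = (∑ k ∈ Finset.range m, α k * ι x ^ (n - 2 * k + 1)) ^ 2 := by
      rw [← mul_pow, Finset.mul_sum]
      congr 1
      exact Finset.sum_congr rfl fun k _ => by ring
    calc W x * (∑ k ∈ Finset.range m, α k * ι x ^ (n - 2 * k)) ^ 2
        ≤ ((n : ℝ) * (n + 1) + 1) * ι x ^ 2 * (∑ k ∈ Finset.range m, α k * ι x ^ (n - 2 * k)) ^ 2 :=
          mul_le_mul_of_nonneg_right (hWle x hx1) (sq_nonneg _)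
      _ = ((n : ℝ) * (n + 1) + 1) * (∑ k ∈ Finset.range m, α k * ι x ^ (n - 2 * k + 1)) ^ 2 := by
          rw [mul_assoc, hιP]
      _ ≤ ((n : ℝ) * (n + 1) + 1) * (m * ∑ k ∈ Finset.range m, (α k * ι x ^ (n - 2 * k + 1)) ^ 2) := by
          refine mul_le_mul_of_nonneg_left ?_ (by positivity)
          have := cs (Finset.range m) (fun k => α k * ι x ^ (n - 2 * k + 1))
          rwa [Finset.card_range] at this
      _ = _ := by
          have hsum : ∑ k ∈ Finset.range m, (α k * ι x ^ (n - 2 * k + 1)) ^ 2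
              = ∑ k ∈ Finset.range m, (α k) ^ 2 * ι x ^ (2 * (n - 2 * k + 1)) :=
            Finset.sum_congr rfl fun k _ => by rw [mul_pow, pow_mul']
          rw [hsum]; ring
  · -- `Q²`
    set m := (n + 1) / 2
    have hdom : IntegrableOn (fun x => (m : ℝ) * ∑ k ∈ Finset.range m,
        (β k) ^ 2 * ι x ^ (2 * (n - 2 * k))) (Ioi 1) := by
      refine Integrable.const_mul (integrable_finsetSum _ fun k hk => ?_) _
      have hk : 1 ≤ n - 2 * k := by have := Finset.mem_range.1 hk; omega
      exact integrableOn_mul_iota_pow hι hιeq (f := fun _ => (β k) ^ 2) continuous_const (C := (β k) ^ 2)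
        (fun x _ => le_of_eq (abs_of_nonneg (sq_nonneg _))) (p := 2 * (n - 2 * k)) (by omega)
    refine Integrable.mono' hdom ((hQc.pow 2)).aestronglyMeasurable
      ((ae_restrict_iff' measurableSet_Ioi).2 (ae_of_all _ fun x hx => ?_))
    rw [Real.norm_eq_abs, abs_of_nonneg (sq_nonneg _), hQeq x (by linarith [show (1:ℝ) < x from hx])]
    refine (cs _ _).trans ?_
    rw [Finset.card_range]
    refine mul_le_mul_of_nonneg_left (le_of_eq (Finset.sum_congr rfl fun k _ => ?_)) (by positivity)
    rw [mul_pow, pow_mul']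

end Literature.Analysis.PDE
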